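import Mathlib.Analysis.SpecialFunctions.Pow.Real
import HarnessLib

/-!
# THE SEED LETTER'S CLOSED FORM: `K·θ² = C_H(B, r)·σ^{1∕4}` — pen 9's constant (✓p797938 `…OrganTangentSeedHClause`) is θ-UNIFORM and carries
# the seed smallness to the power `1∕4` (row-mass input for ROWMASS-¼)

Cell `ym3-torus` (YM ladder rung R3 = continuum `SU(2)` Yang–Mills on the three-torus — a RUNG, NOT d = 4, NOT infinite volume, NOT a mass
gap, NOT Clay).  LEAD-20520 width seat `ym-ust-20520-w3` (gen 24); `--supports stmt-QuantumFields-20520 --as helper`, count-neutral,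
definition-free, default heartbeats; pure real arithmetic (Mathlib only).

WHAT THIS IS.  ✓p797938 `hClauseSq_of_seed_of_analytic` delivers the seed H-letters as
`k b b′ := (25·(2·(4·(3B)∕(rθ − rθ∕4)))^{1∕2} ∕ (rθ∕8·(1∕2)²) · (25·(2·(3B))^{1∕2} ∕ (rθ∕8·(1∕2)²)·σ^{1−1∕2})^{1−1∕2}) · θ²` with
`σ := ωT·e^{−κ·tdist b b′}` (✓p796245's constant at `ρ = rθ, a = rθ∕4, s₁ = rθ∕8, r = r′ = 1∕2`).  This file proves the CLOSED FORM
★`seedLetter_eq`: that expression equals `(800·√(32B)·√(800·√(6B)) ∕ r²)·√(√σ)` for `θ, r, B, σ > 0` — θ drops out (the letters are uniform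
in the window scale) and the seed smallness enters as `σ^{1∕4} = √√σ`; ★`closedForm_mono` (monotone in `σ`), `sqrt_sqrt_mul_exp_neg` (`√√(ω·e^{−κd}) = √√ω·e^{−κd∕4}`).  So the row-mass of the seed
letters with weight `e^{κ′·tdist}` is `C_H·ωT^{1∕4}·Σ_{b′} e^{−(κ∕4 − κ′)·tdist}` (ROWMASS-¼ over ✓`B3TorusRadialSums.sum_exp_neg_tdist_le`).
WHAT THIS IS NOT: arithmetic; nothing of Bałaban's; O1ᵘ-H∕S2ᴴ∕20520∕`YM3TorusSU2` NOT proved.  R3 = SU(2) YM₃ on T³ — NOT d = 4, NOT infinite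
volume, NOT a mass gap, NOT Clay; the Yang–Mills mass gap is NOT proved.
-/

noncomputable section

namespace Summit.QuantumFields.YangMills.Theorems.OrganTangentSeedLetterShape

/-- `x^{1∕2} = √x`. [folklore] -/
theorem rpow_half_eq_sqrt (x : ℝ) : x ^ (1 / 2 : ℝ) = Real.sqrt x := by
  rw [Real.sqrt_eq_rpow]

/-- `x^{1 − 1∕2} = √x`. [folklore] -/
theorem rpow_one_sub_half_eq_sqrt (x : ℝ) : x ^ (1 - 1 / 2 : ℝ) = Real.sqrt x := by
  rw [show (1 - 1 / 2 : ℝ) = 1 / 2 by norm_num, rpow_half_eq_sqrt x]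

/-- ★ **CLOSED FORM OF THE SEED LETTER**: pen 9's constant times `θ²` equals `(800·√(32B)·√(800·√(6B))∕r²)·√(√σ)` — θ-free, `σ^{1∕4}`.
[folklore] -/
theorem seedLetter_eq {θ r B σ : ℝ} (hθ : 0 < θ) (hr : 0 < r) (hB : 0 < B) (hσ : 0 < σ) :
    (25 * (2 * (4 * (3 * B) / (r * θ - r * θ / 4))) ^ (1 / 2 : ℝ) / (r * θ / 8 * (1 / 2 : ℝ) ^ 2) *
        (25 * (2 * (3 * B)) ^ (1 / 2 : ℝ) / (r * θ / 8 * (1 / 2 : ℝ) ^ 2) * σ ^ (1 - 1 / 2 : ℝ)) ^ (1 - 1 / 2 : ℝ)) * θ ^ 2 =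
      800 * Real.sqrt (32 * B) * Real.sqrt (800 * Real.sqrt (6 * B)) / r ^ 2 * Real.sqrt (Real.sqrt σ) := by
  have hrθ : 0 < r * θ := mul_pos hr hθ
  -- rewrite the inner fractions
  have e1 : 2 * (4 * (3 * B) / (r * θ - r * θ / 4)) = 32 * B / (r * θ) := by
    field_simp; ring
  have e2 : r * θ / 8 * (1 / 2 : ℝ) ^ 2 = r * θ / 32 := by ring
  rw [e1, e2]
  -- all rpow's are square roots
  rw [rpow_half_eq_sqrt, rpow_half_eq_sqrt, rpow_one_sub_half_eq_sqrt]
  rw [rpow_one_sub_half_eq_sqrt]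
  -- split the square roots
  have s1 : Real.sqrt (32 * B / (r * θ)) = Real.sqrt (32 * B) / Real.sqrt (r * θ) := Real.sqrt_div' _ hrθ.le
  have s2 : Real.sqrt (25 * Real.sqrt (2 * (3 * B)) / (r * θ / 32) * Real.sqrt σ) =
      Real.sqrt (800 * Real.sqrt (6 * B)) / Real.sqrt (r * θ) * Real.sqrt (Real.sqrt σ) := by
    have : 25 * Real.sqrt (2 * (3 * B)) / (r * θ / 32) * Real.sqrt σ = (800 * Real.sqrt (6 * B) / (r * θ)) * Real.sqrt σ := by
      rw [show 2 * (3 * B) = 6 * B by ring]; field_simp; ring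
    rw [this, Real.sqrt_mul (by positivity), Real.sqrt_div' _ hrθ.le]
  rw [s1, s2]
  -- clear denominators: √(rθ)·√(rθ) = rθ
  have hsq : Real.sqrt (r * θ) * Real.sqrt (r * θ) = r * θ := Real.mul_self_sqrt hrθ.le
  have hsqpos : 0 < Real.sqrt (r * θ) := Real.sqrt_pos.mpr hrθ
  field_simp
  nlinarith [hsq, hsqpos, hrθ, hθ, hr, Real.sqrt_nonneg (32 * B), Real.sqrt_nonneg (800 * Real.sqrt (6 * B)),
    Real.sqrt_nonneg (Real.sqrt σ)]

/-- ★ The closed form is MONOTONE in the seed smallness `σ` (for the row-mass bound: replace `σ_{bb′}` by any majorant). [folklore] -/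
theorem closedForm_mono {r B σ σ' : ℝ} (hr : 0 < r) (hσσ' : σ ≤ σ') :
    800 * Real.sqrt (32 * B) * Real.sqrt (800 * Real.sqrt (6 * B)) / r ^ 2 * Real.sqrt (Real.sqrt σ) ≤
      800 * Real.sqrt (32 * B) * Real.sqrt (800 * Real.sqrt (6 * B)) / r ^ 2 * Real.sqrt (Real.sqrt σ') := by
  have hC : 0 ≤ 800 * Real.sqrt (32 * B) * Real.sqrt (800 * Real.sqrt (6 * B)) / r ^ 2 := by positivity
  exact mul_le_mul_of_nonneg_left (Real.sqrt_le_sqrt (Real.sqrt_le_sqrt hσσ')) hC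

/-- ★ `√√(ω·e^{−κd}) = √√ω·e^{−κd∕4}`: `√(√(ω * exp (−x))) = √(√ω) * exp (−x∕4)` for `0 ≤ ω`. [folklore] -/
theorem sqrt_sqrt_mul_exp_neg {ω x : ℝ} (hω : 0 ≤ ω) :
    Real.sqrt (Real.sqrt (ω * Real.exp (-x))) = Real.sqrt (Real.sqrt ω) * Real.exp (-x / 4) := by
  have he : 0 ≤ Real.exp (-x / 4) := (Real.exp_pos _).le
  have h2 : Real.exp (-x / 2) = Real.exp (-x / 4) * Real.exp (-x / 4) := by
    rw [← Real.exp_add]; ring_nf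
  have h1 : Real.exp (-x) = Real.exp (-x / 2) * Real.exp (-x / 2) := by
    rw [← Real.exp_add]; ring_nf
  have hs1 : Real.sqrt (Real.exp (-x)) = Real.exp (-x / 2) := by
    rw [h1, Real.sqrt_mul_self (Real.exp_pos _).le]
  have hs2 : Real.sqrt (Real.exp (-x / 2)) = Real.exp (-x / 4) := by
    rw [h2, Real.sqrt_mul_self he]
  rw [Real.sqrt_mul hω, hs1, Real.sqrt_mul (Real.sqrt_nonneg _), hs2]

end Summit.QuantumFields.YangMills.Theorems.OrganTangentSeedLetterShape

end
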